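import Summits.AtomisticToContinuum.BoseEinsteinCondensation.Theses.BECHardSphereReduction
import Summits.AtomisticToContinuum.BoseEinsteinCondensation.Theorems.BECHardSphereReductionHardCoreDominatesTransferSchema
import Summits.AtomisticToContinuum.BoseEinsteinCondensation.Theorems.BECHardSphereReductionHardCoreDominatesMaxOccupationStability
import Summits.AtomisticToContinuum.BoseEinsteinCondensation.Theorems.BECHardSphereReductionHardCoreDominatesDirichletRellich
import Summits.AtomisticToContinuum.BoseEinsteinCondensation.Theorems.BECHardSphereReductionHardCoreDominatesHardSphereClosedEnergy
import Summits.AtomisticToContinuum.BoseEinsteinCondensation.Theorems.BECHardSphereReductionHardCoreDominatesCutToHardCoreOf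

/-!
# Line `birth` — the exact RESIDUE of the line after cycle 1 (lead c1, 2026-08-17)

Companion workfile of the skeleton `Lines/birth.lean` (v4). All functional-analysis stubs of the line are
landed; lower semicontinuity of `condensateNumber` at the hard-core end of the coupling path
`v_t = v + t·1_{Iic R}` is a THEOREM (`continuityAtHardCore'` below, sorry-free, re-derived here from the five
landed files so that this file does not import the sorried skeleton). The skeleton consumes the one open stub
`stub_covarianceSign` (monotonicity in `t`, dilute window) only at `s = 0`; this file records, kernel-checked and
sorry-free, the two weaker hypotheses that already give the crux:

* `HardCoreDominates_of_pathDominated` — domination of the path by its start, `∀ t, cn(v_t) ≤ cn(v)` (dilute window);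
* `HardCoreDominates_of_frequentlyDominated` — the same only FREQUENTLY along `t → ∞` (given upper semicontinuity
  at the hard core this is equivalent to the crux: the floor of the line).

Nothing here is registered; these are documentation theorems for the planners / the disprover.
-/

namespace Summit.AtomisticToContinuum.BoseEinsteinCondensation.Cruxes.HardCoreDominates.BirthResidue

open Literature.MathematicalPhysics.QuantumManyBody.BoseGas
open Summit.AtomisticToContinuum.BoseEinsteinCondensation.Cruxes.HardCoreDominates.Birth

/-- `(x ^ 2) ^ (1/2) = x` in `ℝ≥0∞`. [folklore] -/
theorem sq_rpow_half' (x : ENNReal) : (x ^ 2) ^ (1 / 2 : ℝ) = x := by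
  rw [← ENNReal.rpow_natCast, ← ENNReal.rpow_mul]
  norm_num

/-- **Lower semicontinuity of the ground-state condensate number at the hard core** (former stub 2 of the line,
now unconditional): for every measurable `v` of range `R > 0` and EVERY `N, L`,
`condensateNumber HS_R N L ≤ liminf_{t → ∞} condensateNumber (v + t·1_{Iic R}) N L`. Assembled from the landed
`stub_transferSchema`, `stub_cutToHardCore_of stub_dirichletRellich stub_hardSphereClosedEnergy`,
`stub_maxOccupationStability`. [folklore] -/
theorem continuityAtHardCore' (v : ℝ → ENNReal) (R : ℝ) (hmeas : Measurable v) (hR : 0 < R)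
    (hvR : ∀ r : ℝ, R < r → v r = 0) (N : ℕ) (L : ℝ) :
    condensateNumber (Set.indicator (Set.Iic R) (fun _ : ℝ => (⊤ : ENNReal))) N L ≤
      Filter.liminf (fun t : NNReal =>
        condensateNumber (v + Set.indicator (Set.Iic R) (fun _ : ℝ => (t : ENNReal))) N L) Filter.atTop := by
  refine stub_transferSchema v R N L fun δ hδ η hη => ?_
  set ε : ENNReal := (η / (2 * (N : ENNReal) + 1)) ^ 2 with hε
  have hden : (2 * (N : ENNReal) + 1) ≠ ⊤ :=
    ENNReal.add_ne_top.2 ⟨ENNReal.mul_ne_top (by norm_num) (ENNReal.natCast_ne_top N),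
      ENNReal.one_ne_top⟩
  have hden0 : (2 * (N : ENNReal) + 1) ≠ 0 := by positivity
  have hεpos : 0 < ε := by
    rw [hε]
    exact ENNReal.pow_pos (ENNReal.div_pos hη.ne' hden) 2
  have hεη : 2 * (N : ENNReal) * ε ^ (1 / 2 : ℝ) ≤ η := by
    rw [hε, sq_rpow_half']
    calc 2 * (N : ENNReal) * (η / (2 * (N : ENNReal) + 1))
        ≤ (2 * (N : ENNReal) + 1) * (η / (2 * (N : ENNReal) + 1)) := by
          gcongr
          exact le_self_add
      _ = η := ENNReal.mul_div_cancel hden0 hden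
  obtain ⟨T, hT⟩ := stub_cutToHardCore_of stub_dirichletRellich stub_hardSphereClosedEnergy v R hmeas hR
    hvR N L δ hδ ε hεpos
  refine ⟨T, fun t ht => ?_⟩
  obtain ⟨δ', hδ', hΨ⟩ := hT t ht
  refine ⟨δ', hδ', fun Ψ hE => ?_⟩
  obtain ⟨Φ, hΦE, hdist⟩ := hΨ Ψ hE
  refine ⟨Φ, hΦE, (stub_maxOccupationStability N L Φ Ψ).trans ?_⟩
  gcongr ?_ + ?_
  · exact le_rfl
  · refine le_trans ?_ hεη
    gcongr

/-! ## The two residue forms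

`HardCoreDominates_of` uses `stub_covarianceSign` only at `s = 0`, i.e. DOMINATION OF THE PATH BY ITS START; and
since `continuityAtHardCore` is a `liminf` inequality, FREQUENT domination already suffices. Both weaker hypotheses
below are still crux-strength (neither is registered; they document the exact residue of the line). -/

/-- **Residue form 1 (path dominated by its start).** If in a dilute window `cn(v + t·1_{Iic R}) ≤ cn(v)` for every
finite coupling `t`, then `HardCoreDominates` (by the landed lower semicontinuity at the hard core). [folklore] -/
theorem HardCoreDominates_of_pathDominated
    (h : ∀ (v : ℝ → ENNReal) (R : ℝ), Measurable v → 0 < R → (∀ r : ℝ, R < r → v r = 0) →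
      ∃ η₀ : ℝ, 0 < η₀ ∧ ∀ (N : ℕ) (L : ℝ), (N : ℝ) * R ^ 3 ≤ η₀ * L ^ 3 → ∀ t : NNReal,
        condensateNumber (v + Set.indicator (Set.Iic R) (fun _ : ℝ => (t : ENNReal))) N L ≤
          condensateNumber v N L) :
    Summit.AtomisticToContinuum.BoseEinsteinCondensation.Theses.BECHardSphereReduction.HardCoreDominates := by
  intro v R hmeas hR hvR
  obtain ⟨η₁, hη₁, hdom⟩ := h v R hmeas hR hvR
  obtain ⟨η₂, hη₂, hlsc⟩ : ∃ η₂ : ℝ, 0 < η₂ ∧ ∀ (N : ℕ) (L : ℝ), (N : ℝ) * R ^ 3 ≤ η₂ * L ^ 3 →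
      condensateNumber (Set.indicator (Set.Iic R) (fun _ : ℝ => (⊤ : ENNReal))) N L ≤
        Filter.liminf (fun t : NNReal =>
          condensateNumber (v + Set.indicator (Set.Iic R) (fun _ : ℝ => (t : ENNReal))) N L) Filter.atTop :=
    ⟨1, one_pos, fun N L _ => continuityAtHardCore' v R hmeas hR hvR N L⟩
  refine ⟨min η₁ η₂, lt_min hη₁ hη₂, fun N L hNL => ?_⟩
  have hL3 : 0 ≤ L ^ 3 := by
    by_contra hneg
    push Not at hneg
    have hlt : (N : ℝ) * R ^ 3 < 0 :=
      hNL.trans_lt (mul_neg_of_pos_of_neg (lt_min hη₁ hη₂) hneg)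
    exact absurd hlt (not_lt.2 (by positivity))
  have hN₁ : (N : ℝ) * R ^ 3 ≤ η₁ * L ^ 3 :=
    hNL.trans (mul_le_mul_of_nonneg_right (min_le_left _ _) hL3)
  have hN₂ : (N : ℝ) * R ^ 3 ≤ η₂ * L ^ 3 :=
    hNL.trans (mul_le_mul_of_nonneg_right (min_le_right _ _) hL3)
  exact (hlsc N L hN₂).trans
    (Filter.liminf_le_of_frequently_le' (Filter.Eventually.of_forall (hdom N L hN₁)).frequently)

/-- **Residue form 2 (frequent domination).** It even suffices that `cn(v + t·1_{Iic R}) ≤ cn(v)` for ARBITRARILY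
LARGE couplings `t` (frequently along `t → ∞`) in a dilute window. Given upper semicontinuity at the hard core
this form is equivalent to the crux itself, so it is recorded only to mark the floor of the line. [folklore] -/
theorem HardCoreDominates_of_frequentlyDominated
    (h : ∀ (v : ℝ → ENNReal) (R : ℝ), Measurable v → 0 < R → (∀ r : ℝ, R < r → v r = 0) →
      ∃ η₀ : ℝ, 0 < η₀ ∧ ∀ (N : ℕ) (L : ℝ), (N : ℝ) * R ^ 3 ≤ η₀ * L ^ 3 →
        ∃ᶠ t : NNReal in Filter.atTop,
          condensateNumber (v + Set.indicator (Set.Iic R) (fun _ : ℝ => (t : ENNReal))) N L ≤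
            condensateNumber v N L) :
    Summit.AtomisticToContinuum.BoseEinsteinCondensation.Theses.BECHardSphereReduction.HardCoreDominates := by
  intro v R hmeas hR hvR
  obtain ⟨η₁, hη₁, hdom⟩ := h v R hmeas hR hvR
  obtain ⟨η₂, hη₂, hlsc⟩ : ∃ η₂ : ℝ, 0 < η₂ ∧ ∀ (N : ℕ) (L : ℝ), (N : ℝ) * R ^ 3 ≤ η₂ * L ^ 3 →
      condensateNumber (Set.indicator (Set.Iic R) (fun _ : ℝ => (⊤ : ENNReal))) N L ≤
        Filter.liminf (fun t : NNReal =>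
          condensateNumber (v + Set.indicator (Set.Iic R) (fun _ : ℝ => (t : ENNReal))) N L) Filter.atTop :=
    ⟨1, one_pos, fun N L _ => continuityAtHardCore' v R hmeas hR hvR N L⟩
  refine ⟨min η₁ η₂, lt_min hη₁ hη₂, fun N L hNL => ?_⟩
  have hL3 : 0 ≤ L ^ 3 := by
    by_contra hneg
    push Not at hneg
    have hlt : (N : ℝ) * R ^ 3 < 0 :=
      hNL.trans_lt (mul_neg_of_pos_of_neg (lt_min hη₁ hη₂) hneg)
    exact absurd hlt (not_lt.2 (by positivity))
  have hN₁ : (N : ℝ) * R ^ 3 ≤ η₁ * L ^ 3 :=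
    hNL.trans (mul_le_mul_of_nonneg_right (min_le_left _ _) hL3)
  have hN₂ : (N : ℝ) * R ^ 3 ≤ η₂ * L ^ 3 :=
    hNL.trans (mul_le_mul_of_nonneg_right (min_le_right _ _) hL3)
  exact (hlsc N L hN₂).trans (Filter.liminf_le_of_frequently_le' (hdom N L hN₁))

end Summit.AtomisticToContinuum.BoseEinsteinCondensation.Cruxes.HardCoreDominates.BirthResidue
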